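import Summits.Parity.GeneralizedHardyLittlewood.Theorems.PsiGradedTablesClosePoly.Negative.LinearPieceThreshold
import Literature.NumberTheory.LFunctions.Zhang2022.KnifeEdgeLenZDegreeRecordWidth
import HarnessLib

/-!
# Two closed-form triples: one that closes on NO class, one that closes on EVERY class containing `(0.9 − x, 0.9 − x)`

Supports `Summit.Parity.GeneralizedHardyLittlewood.Theses.ZDegreeToeplitzBand.PsiGradedTablesClosePoly` (stmt-Parity-22438) on the
NEGATIVE lane ((A)-free; no Theses statement asserted; no `def`; standard axioms).

The reshaped line `Cruxes/PsiGradedTablesClosePoly/Lines/long_poly_dil.lean` (v2, 209a78611c66a3d2) SEALS its display hole as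
`longPolyForms : PsiGradedClosedForms := Classical.choice _` and runs the (A)-free sign test `stub_signTestClosedForms :
GradedClosesOn SubUnitPolyPairs longPolyForms.X₁psi longPolyForms.Y₁psi longPolyForms.X₂psiDiag` on it. A closed statement about an
uninterpreted `Classical.choice h` is derivable only if it holds for every inhabitant of the type, and refutable only if it fails
for every inhabitant (meta: interpret `choice` at that type by the offending inhabitant). This file supplies BOTH offending
inhabitants as kernel facts, so the sealed stub is provably out of reach of provers AND refuters until the body swap:

* `not_gradedClosesOn_emptyForms` — the EMPTY triple `⟨[], [], []⟩` is dark (`X₁psi = Y₁psi = X₂psiDiag = 0`) and closes on no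
  class (`not_gradedClosesOn_of_darkOn`); hence `not_forall_forms_gradedClosesOn`.
* `gradedClosesOn_pointForms` — the ONE-ATOM triple `x₂ := [ptPt (−52) 0 0]` has `X₂psiDiag(ℓ,ℓ) = −52·ℓ(0)² = −42.12` at the
  linear piece `ℓ = 0.9 − x`, `‖X₂‖² = 1774.09 ≥ 1764`, so it closes on every class containing the pair `(ℓ,ℓ)` by
  `gradedClosesOn_linear_nine_tenths_of_cell` (p594558) — in particular on the sub-unit polynomial pair class
  (`subUnitPolyToken_linear`); hence `not_forall_forms_not_gradedClosesOn_subUnitPoly`.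
-/

noncomputable section

open Complex Real ComplexConjugate Polynomial Set

namespace Summit.Parity.GeneralizedHardyLittlewood.Theorems.PsiGradedTablesClosePoly.Negative

open Literature.NumberTheory.LFunctions.Zhang2022 Literature.NumberTheory.LFunctions.Zhang2022.KnifeEdge

/-! ### Part 1 — the dark inhabitant: the sealed sign test is not PROVABLE -/

/-- **The empty closed-form triple closes on no class:** its three tables are the zero functional (`ClosedForm.eval_nil`,
`conjLeft 0 = 0`), and dark tables pass no sign test (`not_gradedClosesOn_of_darkOn`, diagonal `𝔅 ≥ 0`).
[cite: Zhang2022LandauSiegel, §2 (2.16), §7 Prop 7.1] -/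
theorem not_gradedClosesOn_emptyForms (𝒞 : PairClass) :
    ¬ GradedClosesOn 𝒞
      (PsiGradedClosedForms.X₁psi ⟨[], [], [], ClosedForm.kernelsContinuous_nil, ClosedForm.kernelsContinuous_nil,
        ClosedForm.kernelsContinuous_nil⟩)
      (PsiGradedClosedForms.Y₁psi ⟨[], [], [], ClosedForm.kernelsContinuous_nil, ClosedForm.kernelsContinuous_nil,
        ClosedForm.kernelsContinuous_nil⟩)
      (PsiGradedClosedForms.X₂psiDiag ⟨[], [], [], ClosedForm.kernelsContinuous_nil, ClosedForm.kernelsContinuous_nil,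
        ClosedForm.kernelsContinuous_nil⟩) := by
  refine not_gradedClosesOn_of_darkOn fun f f' g g' _ _ _ => ?_
  simp only [PsiGradedClosedForms.X₁psi, PsiGradedClosedForms.Y₁psi, PsiGradedClosedForms.X₂psiDiag, ClosedForm.eval_nil,
    conjLeft, Pi.zero_apply, and_self]

/-- **Not every closed-form triple closes** (on any class): the empty triple does not. Reading: the SEALED stub
`GradedClosesOn SubUnitPolyPairs (Classical.choice _).X₁psi …` is not derivable. [cite: Zhang2022LandauSiegel, §2 (2.16)] -/
theorem not_forall_forms_gradedClosesOn (𝒞 : PairClass) :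
    ¬ ∀ E : PsiGradedClosedForms, GradedClosesOn 𝒞 E.X₁psi E.Y₁psi E.X₂psiDiag :=
  fun h => not_gradedClosesOn_emptyForms 𝒞 (h _)

/-! ### Part 2 — the live inhabitant: the sealed sign test is not REFUTABLE -/

/-- The one-atom point form `[ptPt w 0 0]` has its marked points in `[0,1]`. [cite: Zhang2022LandauSiegel, §7 Prop 7.1 (7.2)] -/
theorem kernelsContinuous_ptPt_zero_zero (w : ℂ) : ClosedForm.KernelsContinuous [ClosedFormAtom.ptPt w 0 0] :=
  ClosedForm.KernelsContinuous.cons (ClosedFormAtom.kernelsContinuous_ptPt w ⟨le_rfl, zero_le_one⟩ ⟨le_rfl, zero_le_one⟩)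
    ClosedForm.kernelsContinuous_nil

/-- The value of the linear piece `0.9 − x` at `0` is `0.9`. [cite: Zhang2022LandauSiegel, §7 (7.2) p.13] -/
theorem polyPiece_linear_nine_tenths_zero :
    polyPiece (9/10) (C ((9/10 : ℝ) : ℂ) - X) 0 = ((9/10 : ℝ) : ℂ) := by
  rw [polyPiece_linear]
  norm_num

/-- **The conjugated one-atom point table at the linear pair:** `conjLeft [ptPt w 0 0] (ℓ,ℓ′,ℓ,ℓ′) = w · 0.81` for
`ℓ = 0.9 − x` (any marked derivative). [cite: Zhang2022LandauSiegel, §7 Prop 7.1 (7.2)] -/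
theorem conjLeft_ptPt_linear_nine_tenths (w : ℂ) (ℓ' : ℝ → ℂ) :
    conjLeft (ClosedForm.eval [ClosedFormAtom.ptPt w 0 0])
      (polyPiece (9/10) (C ((9/10 : ℝ) : ℂ) - X)) ℓ' (polyPiece (9/10) (C ((9/10 : ℝ) : ℂ) - X)) ℓ'
      = w * (((81/100 : ℝ)) : ℂ) := by
  simp only [ClosedForm.eval_cons, ClosedForm.eval_nil, conjLeft, Pi.add_apply, Pi.zero_apply,
    ClosedFormAtom.eval_ptPt, pointPair, polyPiece_linear_nine_tenths_zero, Complex.conj_ofReal, add_zero]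
  push_cast
  ring

/-- **The one-atom triple `x₂ := [ptPt (−52) 0 0]` closes on every class containing the linear pair `(0.9 − x, 0.9 − x)`:**
its NEW table there is `−52 · 0.81 = −42.12`, `‖·‖² = 1774.0944 ≥ 1764 = 42² > 𝔅²` (`41.98 < 𝔅(0.9 − x) < 42`), so
`gradedClosesOn_linear_nine_tenths_of_cell` fires, whatever the degree-1 tables. [cite: Zhang2022LandauSiegel, §2 (2.16), §7 Prop 7.1 (7.2)] -/
theorem gradedClosesOn_pointForms {𝒞 : PairClass}
    (h𝒞 : 𝒞 (polyPiece (9/10) (C ((9/10 : ℝ) : ℂ) - X)) (polyPieceDeriv (9/10) (C ((9/10 : ℝ) : ℂ) - X))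
      (polyPiece (9/10) (C ((9/10 : ℝ) : ℂ) - X)) (polyPieceDeriv (9/10) (C ((9/10 : ℝ) : ℂ) - X))) :
    GradedClosesOn 𝒞
      (PsiGradedClosedForms.X₁psi ⟨[], [], [ClosedFormAtom.ptPt (-52) 0 0], ClosedForm.kernelsContinuous_nil,
        ClosedForm.kernelsContinuous_nil, kernelsContinuous_ptPt_zero_zero (-52)⟩)
      (PsiGradedClosedForms.Y₁psi ⟨[], [], [ClosedFormAtom.ptPt (-52) 0 0], ClosedForm.kernelsContinuous_nil,
        ClosedForm.kernelsContinuous_nil, kernelsContinuous_ptPt_zero_zero (-52)⟩)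
      (PsiGradedClosedForms.X₂psiDiag ⟨[], [], [ClosedFormAtom.ptPt (-52) 0 0], ClosedForm.kernelsContinuous_nil,
        ClosedForm.kernelsContinuous_nil, kernelsContinuous_ptPt_zero_zero (-52)⟩) := by
  refine gradedClosesOn_linear_nine_tenths_of_cell h𝒞 ?_
  simp only [PsiGradedClosedForms.X₂psiDiag]
  have hcast : (-52 : ℂ) * (((81/100 : ℝ)) : ℂ) = ((-52 * (81/100) : ℝ) : ℂ) := by push_cast; ring
  rw [conjLeft_ptPt_linear_nine_tenths, hcast, Complex.norm_real, Real.norm_eq_abs, sq_abs]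
  norm_num

/-- **Not every closed-form triple FAILS to close on the sub-unit polynomial pair class** (the class of the line, written
out: both pieces `PolyShortPiece θ` for some `θ < 1`): the one-atom triple closes there, the linear pair being in the class by
`subUnitPolyToken_linear`. Reading: the NEGATION of the sealed stub is not derivable either — sealed = kernel-independent.
[cite: Zhang2022LandauSiegel, §2 (2.16), §7 (7.2)] -/
theorem not_forall_forms_not_gradedClosesOn_subUnitPoly :
    ¬ ∀ E : PsiGradedClosedForms, ¬ GradedClosesOn
      (fun f f' g g' => (∃ θ : ℝ, θ < 1 ∧ PolyShortPiece θ f f') ∧ (∃ θ : ℝ, θ < 1 ∧ PolyShortPiece θ g g'))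
      E.X₁psi E.Y₁psi E.X₂psiDiag :=
  fun h => h _ (gradedClosesOn_pointForms
    ⟨subUnitPolyToken_linear (θ := 9/10) (by norm_num), subUnitPolyToken_linear (θ := 9/10) (by norm_num)⟩)

end Summit.Parity.GeneralizedHardyLittlewood.Theorems.PsiGradedTablesClosePoly.Negative

end
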